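import Summits.QuantumFields.YangMills.Theorems.FluctuationComparisonRegPrIntLS2BetaCurlBudgetT3
import Summits.QuantumFields.YangMills.Theorems.FluctuationComparisonRegPrIntLS2BetaRowsRescale
import Summits.QuantumFields.YangMills.Theorems.FluctuationComparisonRegPrIntLS2BetaTorusReadTransport
import HarnessLib

/-!
# S2β · (SCT″-c)₁ THE c₁ BUDGET CORE, FILE 1 of 2 — «THE ENGINE OVER ALL ORIENTATIONS ON THE c₁ READ CELLS»: ✓`weighted_readMax_sq_le_sources_T3` run once per
# plaquette orientation `μ < ν` on the ✓`rows_rescale`d family, the rescaling undone by ✓`sq_le_exp_mul_rescaled_sq`, endpoint multiplicity `η = 6`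
# (✓`card_filter_mem_ends_le`), GENERIC read thickness `θr` (c₁ TEXT v2 of record = `θr := L + 2`; architect 21:48:59Z «≥ 2L+1» for the c₃ boxes = `θr := 2L + 1`)

Cell `ym3-torus` (YM ladder rung R3 = continuum `SU(2)` Yang–Mills on the three-torus at fixed lattice data — a RUNG: NOT d = 4, NOT infinite volume, NOT a mass gap,
NOT Clay).  Width seat «width 10» `ym3-torus-px10` (gen 26), station-owner lineage of ✓p834059; crux `stmt-QuantumFields-20520`, LINE g18-1 S2β; the c₁ BUDGET CORE
`…S2BetaCurlBudget` (architect px17 g22 2026-08-31T21:24:01Z NAMED, px16 lineage ∕ px16 g24 KEEP 21:38:00Z; recipe = px16 g23 § FINAL, HANDOFF l.14093).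
`--kind proof --supports stmt-QuantumFields-20520 --as helper`, count-neutral, DEFINITION-FREE (0 `def`, 0 `instance`, 0 `notation`, 0 `sorry`, default heartbeats).

WHY.  The c₁ TEXT v2 (ADOPTED 19:51Z; read thickness kept GENERIC `θr` here — `L + 2` of record, `2L + 1` for the c₃ boxes per the architect 21:48:59Z) is `c₁ t = Cst·Σ_B ‖p ↦ 𝟙[p.src in B's read cell at internal level n = K−J−1−t]·dist1((P_{Ū^n U₀} p)⁻¹ P_{Ū^n(e^ζ U₀)} p)‖²` (Pi-sup, group
currency); its (ST)-weighted budget `Σ_t L^t c₁ t` is, after ✓`exists_sel_sq_pi_norm_trunc_le`, a sum over ORIENTATION PAIRS of exactly the left side of px13∕px16's source-budget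
engine at `Λ n = Cst·L^{K−J−1−n}` — for a family obeying the `(1+ε)`-ROWS.  THIS FILE runs that engine per orientation on the rescaled family `ρ̂ = ρ∕Π(1+ε)` (coefficient-ONE
rows, ✓`rows_rescale`), undoes the rescaling (`ρ² ≤ e^{2Σε}ρ̂²`), discharges the endpoint multiplicity and the exponent bookkeeping `L^{K−J−1}∕L^{4j}·(L³)^j ≤ L^{K−J−1−j}`,
and sums the orientations: the data enter as `Σ_{μ<ν} Σ_z ρ_{μν,0}(z)²`, the sources as `Σ_j w_j·L^{K−J−1−j}·Σ_{μν,c} src_j²` with the consumer's Cauchy–Schwarz weights `w`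
(`Σ_{j∈Icc 1 n} w_j⁻¹ ≤ W`; `w_j = 2^j`, `W = 1` is ★`sum_Icc_inv_two_pow_le_one`).  FILE 2 (`…S2BetaCurlBudget`) puts the c₁ TEXT on the left and the purse's REL on the right.

WHAT IS PROVED (sorry-free).  §1 ★`sum_plaq_eq_sum_ite` (plaquette sums = orientation-filtered site sums), ★`sum_Icc_inv_two_pow_le_one`; §2 ★`readCell_nonempty` (the c₁ read
cell of every coarsest bond is inhabited at every level), ★`kernelConst_nonneg`, ★★★`weighted_orient_sum_le` (display in its docstring).

HONEST SCOPE.  Finite bookkeeping over LANDED letters (px13 g27 ✓p832878 ∕ px16 g23 ✓p833397 engine, ✓p835103 rescale, ✓p833783 selection, ✓p832898 junction, ✓`card_filter_mem_ends_le`);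
nothing of Bałaban's renormalisation-group analysis is asserted or proved ([Balaban1985Averaging] (19)–(20) p.21, Prop. 4 (128)–(135) pp.37–38 and [Balaban1987RG1] (0.1)–(0.4),
(0.11) pp.251–253 are the printed recursion these rows transcribe); ROWS v2 (px13 g28), the ε-letter ((RSP-Σ), px12), the source energies ((BKG)-linear, OSC remainder,
curved pieces — px13), the κ-ratio letter (px16 g24), (iii) (px21), the SUPPLIER KNIT (LEAD w3), NC-ROW′, (ST‴)∕LOC‴, h3 are HYPOTHESES or others'; GAP♯∘
(`stub_uniformFibreGapOrbit`, registry `Lines/semiclassical_s2beta.lean` 3732b7df UNTOUCHED, 0∕5), S2β, the five registered stubs, crux 20520, 19936, 19200 and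
`YM3TorusSU2` are NOT proved; no registered stub is closed; rung R3 = SU(2) YM₃ on T³ at fixed lattice data — NOT d = 4, NOT infinite volume, NOT a mass gap, NOT Clay;
the Yang–Mills mass gap is NOT proved.
-/

set_option autoImplicit false

noncomputable section

open Finset

namespace Summit.QuantumFields.YangMills.Theorems.FluctuationComparisonRegPrIntLS2BetaCurlBudgetEngine

open Literature.MathematicalPhysics.QuantumFieldTheory.Balaban1983to89
open Literature.MathematicalPhysics.QuantumFieldTheory.Balaban1983to89.T4Continuum
open Literature.MathematicalPhysics.QuantumFieldTheory.Balaban1983to89.T3ContinuumYM3Torus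
open Literature.MathematicalPhysics.QuantumFieldTheory.Balaban1983to89.T3LevelShift
open Literature.MathematicalPhysics.QuantumFieldTheory.Balaban1983to89.BlockAveraging (Idx blockAvg)
open Literature.MathematicalPhysics.QuantumFieldTheory.Balaban1983to89.B10Eq47AxialChi (shiftN)
open Literature.MathematicalPhysics.QuantumFieldTheory.Balaban1983to89.B14.Eq22Determines (blockIter)
open Literature.MathematicalPhysics.QuantumFieldTheory.Balaban1983to89.B10Eq27TorusAxialLog (rel rel_self)
open Literature.MathematicalPhysics.QuantumFieldTheory.Balaban1983to89.B15DeterminingSets (embIter)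
open Literature.MathematicalPhysics.QuantumFieldTheory.Balaban1983to89.B15Eq177GaugeInvariance (blockIter_embIter)
open Summit.QuantumFields.YangMills.Theorems.FluctuationComparisonRegPrIntLS2BetaCurlBudgetT3 (weighted_readMax_sq_le_sources_T3)
open Summit.QuantumFields.YangMills.Theorems.FluctuationComparisonRegPrIntLS2BetaRowsRescale (rows_rescale sq_le_exp_mul_rescaled_sq rescaled_nonneg)
open Summit.QuantumFields.YangMills.Theorems.FluctuationComparisonRegPrIntLS2BetaTorusReadTransport (card_filter_mem_ends_le)

variable (F : T3Family)

/-! ## §1 Two pieces of finite bookkeeping -/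

/-- ★ A sum over the plaquettes `Plaq P k` (`μ < ν`) of a function of `(src, μ, ν)` is the orientation-filtered triple sum. [folklore] -/
theorem sum_plaq_eq_sum_ite {P : Params} {k : ℕ} (G : Site P k → Fin P.d → Fin P.d → ℝ) :
    ∑ p : Plaq P k, G p.src p.μ p.ν = ∑ μ, ∑ ν, if μ < ν then ∑ z : Site P k, G z μ ν else 0 := by
  classical
  let e : {t : Site P k × Fin P.d × Fin P.d // t.2.1 < t.2.2} ≃ Plaq P k :=
    ⟨fun t => ⟨t.1.1, t.1.2.1, t.1.2.2, t.2⟩, fun p => ⟨(p.src, p.μ, p.ν), p.hμν⟩, fun _ => rfl, fun _ => rfl⟩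
  have h1 : ∑ p : Plaq P k, G p.src p.μ p.ν =
      ∑ q ∈ (univ : Finset (Site P k × Fin P.d × Fin P.d)).filter (fun q => q.2.1 < q.2.2), G q.1 q.2.1 q.2.2 := by
    rw [sum_subtype ((univ : Finset (Site P k × Fin P.d × Fin P.d)).filter (fun q => q.2.1 < q.2.2))
      (p := fun q : Site P k × Fin P.d × Fin P.d => q.2.1 < q.2.2) (fun q => by simp)]
    exact (Fintype.sum_equiv e _ _ fun t => rfl).symm
  have h2 : ∀ μ ν : Fin P.d, (if μ < ν then ∑ z : Site P k, G z μ ν else 0) = ∑ z : Site P k, if μ < ν then G z μ ν else 0 := by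
    intro μ ν
    split_ifs <;> simp
  simp_rw [h2]
  rw [h1, sum_filter, Fintype.sum_prod_type]
  simp_rw [Fintype.sum_prod_type]
  exact Finset.sum_comm.trans (sum_congr rfl fun μ _ => Finset.sum_comm)

/-- ★ `Σ_{j ∈ Icc 1 n} (2^j)⁻¹ ≤ 1` — the geometric Cauchy–Schwarz weights. [folklore] -/
theorem sum_Icc_inv_two_pow_le_one (n : ℕ) : ∑ j ∈ Finset.Icc 1 n, ((2 : ℝ) ^ j)⁻¹ ≤ 1 := by
  have h : ∑ j ∈ Finset.Icc 1 n, ((2 : ℝ) ^ j)⁻¹ = 1 - ((2 : ℝ) ^ n)⁻¹ := by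
    induction n with
    | zero => simp
    | succ n ih =>
        rw [Finset.sum_Icc_succ_top (by omega), ih, pow_succ, mul_inv]
        ring
  rw [h]
  have : 0 < ((2 : ℝ) ^ n)⁻¹ := by positivity
  linarith


/-! ## §2 The read cells are inhabited; the weighted engine over all orientations -/

/-- ★ **THE c₁ READ CELL OF A COARSEST BOND IS INHABITED** at every internal level `n`: the iterated block of the canonical representative of the
transported source `(bondShift _ B).src` reads itself (`rel y y = 0`). [cite: Balaban1987RG1, (0.1)-(0.4) pp.251-253] -/
theorem readCell_nonempty {J K : ℕ} (hJK : J ≤ K) (θr : ℕ) (B : PBond (F.P J) 0) (n : ℕ) :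
    ∃ y : Site (F.P K) n, ∃ z₀ : Site (F.P K) 0, (blockIter (K - J) z₀ = (bondShift (F.sitesPerDir_eq (m := F.m) (K := J) (j := 0) (m' := F.m) (K' := K) (j' := K - J) (by omega)) B).src ∨
            blockIter (K - J) z₀ = (bondShift (F.sitesPerDir_eq (m := F.m) (K := J) (j := 0) (m' := F.m) (K' := K) (j' := K - J) (by omega)) B).tgt) ∧
            ∀ κ, (rel (blockIter n z₀) y κ).natAbs ≤ θr := by
  refine ⟨blockIter n (embIter (K - J) (bondShift (F.sitesPerDir_eq (m := F.m) (K := J) (j := 0) (m' := F.m) (K' := K) (j' := K - J) (by omega)) B).src), embIter (K - J) (bondShift (F.sitesPerDir_eq (m := F.m) (K := J) (j := 0) (m' := F.m) (K' := K) (j' := K - J) (by omega)) B).src, Or.inl ?_, fun κ => ?_⟩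
  · exact blockIter_embIter (P := F.P K) (K - J) (by show K - J ≤ F.m + K; omega) _
  · simp

/-- ★ The composed-kernel constant `κ²·ν·C_b` of ✓`weighted_readMax_sq_le_sources_T3` (`κ = 5³`, `ν = (2(θr+2)+1)³·6`, `C_b = 2(L³−1)∕(L³−3)`) is nonnegative
(`L³ ≥ 8 > 3`). [cite: Balaban1985Averaging, Prop. 4 (128)-(135) pp.37-38] -/
theorem kernelConst_nonneg (K θr : ℕ) : 0 ≤ (((5 ^ (F.P K).d : ℕ) : ℝ) ^ 2 * (((2 * (θr + 2) + 1) ^ (F.P K).d * 6 : ℕ) : ℝ) *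
              (2 * ((((F.P K).L ^ (F.P K).d : ℕ) : ℝ) - 1) / ((((F.P K).L ^ (F.P K).d : ℕ) : ℝ) - 3))) := by
  have hcube : (8 : ℝ) ≤ (((F.P K).L ^ (F.P K).d : ℕ) : ℝ) := by
    have h2 : 2 ≤ F.L := F.hL.2
    have : 2 ^ 3 ≤ F.L ^ 3 := Nat.pow_le_pow_left h2 3
    show (8 : ℝ) ≤ ((F.L ^ 3 : ℕ) : ℝ)
    exact_mod_cast this
  have h1 : (0 : ℝ) ≤ 2 * ((((F.P K).L ^ (F.P K).d : ℕ) : ℝ) - 1) := by linarith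
  have h3 : (0 : ℝ) < (((F.P K).L ^ (F.P K).d : ℕ) : ℝ) - 3 := by linarith
  exact mul_nonneg (by positivity) (div_nonneg h1 h3.le)

/-- ★★ **THE ENGINE OVER ALL ORIENTATIONS, RESCALED** — for nonneg families `ρ_{μν}`, `src_{μν}` obeying the `(1+ε)`-rows (✓`rows_rescale`'s `hrow`, `μ < ν`), admissible
selected sites `sel n B μ ν` in the c₁ read cells (generic thickness `θr`, ends `{σB.src, σB.tgt}`, multiplicity `6` ✓`card_filter_mem_ends_le`), the (ST)-weighted sum of
`ρ_{μν}(sel)²` over levels, coarsest bonds and orientations is at most `e^{2Σε}·2·Cst·κ²ν C_b·(L^{K−J−1}·Σ_{μ<ν}Σ_z ρ_{μν,0}(z)² + W·Σ_j w_j L^{K−J−1−j} Σ_{μν,c} src²)`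
(✓`weighted_readMax_sq_le_sources_T3` per orientation on the rescaled family, ✓`sq_le_exp_mul_rescaled_sq`). [cite: Balaban1985Averaging, Prop. 4 (128)-(135) pp.37-38; Balaban1987RG1, (0.11) p.253] -/
theorem weighted_orient_sum_le {J K : ℕ} (hJK : J ≤ K) (θr : ℕ) (Cst : ℝ) (hCst : 0 ≤ Cst)
    (w : ℕ → ℝ) (hw : ∀ j, 0 < w j) (W : ℝ) (hW : ∀ n, ∑ j ∈ Finset.Icc 1 n, (w j)⁻¹ ≤ W)
    (ρ src : Fin (F.P K).d → Fin (F.P K).d → (i : ℕ) → Site (F.P K) i → ℝ) (ε : ℕ → ℝ)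
    (hρ : ∀ μ ν i x, 0 ≤ ρ μ ν i x) (hsrc : ∀ μ ν i x, 0 ≤ src μ ν i x) (hε : ∀ j, 0 ≤ ε j)
    (hrow : ∀ μ ν, μ < ν → ∀ i, i < K - J → ∀ y' : Site (F.P K) (i + 1),
        ρ μ ν (i + 1) y' ≤ (1 + ε i) * ((Fintype.card (Idx (F.P K)) : ℝ)⁻¹ *
            ∑ a ∈ (Finset.univ : Finset (Idx (F.P K))) ×ˢ (Finset.range (F.P K).L ×ˢ Finset.range (F.P K).L),
              ρ μ ν i (shiftN (shiftN (Site.blockSite y' a.1.1) μ a.2.1) ν a.2.2)) +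
          src μ ν (i + 1) y')
    (sel : (n : ℕ) → PBond (F.P J) 0 → Fin (F.P K).d → Fin (F.P K).d → Site (F.P K) n)
    (hsel : ∀ n B μ ν, ∃ z₀ : Site (F.P K) 0, (blockIter (K - J) z₀ = (bondShift (F.sitesPerDir_eq (m := F.m) (K := J) (j := 0) (m' := F.m) (K' := K) (j' := K - J) (by omega)) B).src ∨
            blockIter (K - J) z₀ = (bondShift (F.sitesPerDir_eq (m := F.m) (K := J) (j := 0) (m' := F.m) (K' := K) (j' := K - J) (by omega)) B).tgt) ∧
            ∀ κ, (rel (blockIter n z₀) (sel n B μ ν) κ).natAbs ≤ θr) :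
    ∑ μ, ∑ ν, ∑ n ∈ Finset.range (K - J + 1), (if n < K - J then Cst * (F.L : ℝ) ^ (K - J - 1 - n) else 0) *
        ∑ B : PBond (F.P J) 0, (if μ < ν then ρ μ ν n (sel n B μ ν) else 0) ^ 2 ≤
      Real.exp (2 * ∑ j ∈ Finset.range (K - J), ε j) * (2 * Cst * ((((5 ^ (F.P K).d : ℕ) : ℝ) ^ 2 * (((2 * (θr + 2) + 1) ^ (F.P K).d * 6 : ℕ) : ℝ) *
              (2 * ((((F.P K).L ^ (F.P K).d : ℕ) : ℝ) - 1) / ((((F.P K).L ^ (F.P K).d : ℕ) : ℝ) - 3))))) *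
        ((F.L : ℝ) ^ (K - J - 1) * ∑ μ, ∑ ν, (if μ < ν then ∑ z : Site (F.P K) 0, ρ μ ν 0 z ^ 2 else 0) +
          W * ∑ j ∈ Finset.Icc 1 (K - J), w j * (F.L : ℝ) ^ (K - J - 1 - j) * ∑ μ, ∑ ν, ∑ c : Site (F.P K) j, src μ ν j c ^ 2) := by
  classical
  have hL1 : (1 : ℝ) ≤ (F.L : ℝ) := by exact_mod_cast F.hL.2.le
  have hL0 : (0 : ℝ) < (F.L : ℝ) := lt_of_lt_of_le zero_lt_one hL1
  have hKL : 0 ≤ (((5 ^ (F.P K).d : ℕ) : ℝ) ^ 2 * (((2 * (θr + 2) + 1) ^ (F.P K).d * 6 : ℕ) : ℝ) *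
              (2 * ((((F.P K).L ^ (F.P K).d : ℕ) : ℝ) - 1) / ((((F.P K).L ^ (F.P K).d : ℕ) : ℝ) - 3))) := kernelConst_nonneg F K θr
  have hΛ : ∀ n, 0 ≤ (if n < K - J then Cst * (F.L : ℝ) ^ (K - J - 1 - n) else 0) := by
    intro n; split_ifs
    · exact mul_nonneg hCst (pow_nonneg hL0.le _)
    · exact le_rfl
  -- exponent bookkeeping for the source weights: `L^{K−J−1}∕L^{4j}·(L³)^j ≤ L^{K−J−1−j}`
  have hpow : ∀ j, (F.L : ℝ) ^ (K - J - 1) / (F.L : ℝ) ^ (4 * j) * (((F.P K).L ^ (F.P K).d : ℕ) : ℝ) ^ j ≤ (F.L : ℝ) ^ (K - J - 1 - j) := by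
    intro j
    have e3 : (((F.P K).L ^ (F.P K).d : ℕ) : ℝ) ^ j = (F.L : ℝ) ^ (3 * j) := by
      show (((F.L ^ 3 : ℕ) : ℝ)) ^ j = (F.L : ℝ) ^ (3 * j)
      push_cast
      rw [← pow_mul]
    rw [e3, div_mul_eq_mul_div, ← pow_add, div_le_iff₀ (pow_pos hL0 _), ← pow_add]
    exact pow_le_pow_right₀ hL1 (by omega)
  -- ONE ORIENTATION `μ < ν`: the engine on the rescaled family, then undo the rescaling
  have hone : ∀ μ ν, μ < ν →
      ∑ n ∈ Finset.range (K - J + 1), (if n < K - J then Cst * (F.L : ℝ) ^ (K - J - 1 - n) else 0) * ∑ B : PBond (F.P J) 0, ρ μ ν n (sel n B μ ν) ^ 2 ≤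
        Real.exp (2 * ∑ j ∈ Finset.range (K - J), ε j) *
          (2 * (Cst * (F.L : ℝ) ^ (K - J - 1) / (F.L : ℝ) ^ (4 * 0) * ((5 ^ (F.P K).d : ℕ) : ℝ) ^ 2 * (((2 * (θr + 2) + 1) ^ (F.P K).d * 6 : ℕ) : ℝ) * (2 * ((((F.P K).L ^ (F.P K).d : ℕ) : ℝ) - 1) / ((((F.P K).L ^ (F.P K).d : ℕ) : ℝ) - 3)) *
              ((((F.P K).L ^ (F.P K).d : ℕ) : ℝ) ^ 0 * ∑ z : Site (F.P K) 0, (ρ μ ν 0 z / ∏ j ∈ Finset.range 0, (1 + ε j)) ^ 2)) +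
            2 * W * ∑ j ∈ Finset.Icc 1 (K - J), w j *
              (Cst * (F.L : ℝ) ^ (K - J - 1) / (F.L : ℝ) ^ (4 * j) * ((5 ^ (F.P K).d : ℕ) : ℝ) ^ 2 * (((2 * (θr + 2) + 1) ^ (F.P K).d * 6 : ℕ) : ℝ) * (2 * ((((F.P K).L ^ (F.P K).d : ℕ) : ℝ) - 1) / ((((F.P K).L ^ (F.P K).d : ℕ) : ℝ) - 3)) *
                ((((F.P K).L ^ (F.P K).d : ℕ) : ℝ) ^ j * ∑ c : Site (F.P K) j, src μ ν j c ^ 2))) := by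
    intro μ ν hμν
    have hrow' := rows_rescale (P := F.P K) (μ := μ) (ν := ν) (K - J) (ρ μ ν) (src μ ν) (hsrc μ ν) ε hε (hrow μ ν hμν)
    have hE := weighted_readMax_sq_le_sources_T3 F hJK (ne_of_lt hμν) (ι := PBond (F.P J) 0)
      (fun B => ({(bondShift (F.sitesPerDir_eq (m := F.m) (K := J) (j := 0) (m' := F.m) (K' := K) (j' := K - J) (by omega)) B).src, (bondShift (F.sitesPerDir_eq (m := F.m) (K := J) (j := 0) (m' := F.m) (K' := K) (j' := K - J) (by omega)) B).tgt} : Finset (Site (F.P K) (K - J)))) θr 6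
      (fun e => card_filter_mem_ends_le (F := F) (show J + (K - J) = K by omega) e)
      (fun i y => ρ μ ν i y / ∏ j ∈ Finset.range i, (1 + ε j)) (src μ ν)
      (fun i y => rescaled_nonneg (ρ μ ν) (hρ μ ν) ε hε i y) (hsrc μ ν) hrow' Cst hCst w hw W (fun n _ => hW n)
      (fun n B => sel n B μ ν) (fun n _ B => by
        obtain ⟨z₀, hz, hκ⟩ := hsel n B μ ν
        exact ⟨z₀, hz.elim (fun h => h ▸ Finset.mem_insert_self _ _) (fun h => h ▸ Finset.mem_insert_of_mem (Finset.mem_singleton_self _)), hκ⟩)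
    have hterm : ∀ n ∈ Finset.range (K - J + 1), ∀ B : PBond (F.P J) 0,
        (if n < K - J then Cst * (F.L : ℝ) ^ (K - J - 1 - n) else 0) * ρ μ ν n (sel n B μ ν) ^ 2 ≤
          Real.exp (2 * ∑ j ∈ Finset.range (K - J), ε j) *
            ((if n < K - J then Cst * (F.L : ℝ) ^ (K - J - 1 - n) else 0) * (ρ μ ν n (sel n B μ ν) / ∏ j ∈ Finset.range n, (1 + ε j)) ^ 2) := by
      intro n hn B
      rw [Finset.mem_range] at hn
      rw [mul_left_comm]
      exact mul_le_mul_of_nonneg_left (sq_le_exp_mul_rescaled_sq (ρ μ ν) ε hε (Nat.le_of_lt_succ hn) _) (hΛ n)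
    calc ∑ n ∈ Finset.range (K - J + 1), (if n < K - J then Cst * (F.L : ℝ) ^ (K - J - 1 - n) else 0) * ∑ B : PBond (F.P J) 0, ρ μ ν n (sel n B μ ν) ^ 2
        = ∑ n ∈ Finset.range (K - J + 1), ∑ B : PBond (F.P J) 0, (if n < K - J then Cst * (F.L : ℝ) ^ (K - J - 1 - n) else 0) * ρ μ ν n (sel n B μ ν) ^ 2 := by
          simp_rw [Finset.mul_sum]
      _ ≤ ∑ n ∈ Finset.range (K - J + 1), ∑ B : PBond (F.P J) 0, Real.exp (2 * ∑ j ∈ Finset.range (K - J), ε j) *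
            ((if n < K - J then Cst * (F.L : ℝ) ^ (K - J - 1 - n) else 0) * (ρ μ ν n (sel n B μ ν) / ∏ j ∈ Finset.range n, (1 + ε j)) ^ 2) :=
          Finset.sum_le_sum fun n hn => Finset.sum_le_sum fun B _ => hterm n hn B
      _ = Real.exp (2 * ∑ j ∈ Finset.range (K - J), ε j) * ∑ n ∈ Finset.range (K - J + 1), (if n < K - J then Cst * (F.L : ℝ) ^ (K - J - 1 - n) else 0) *
            ∑ B : PBond (F.P J) 0, (ρ μ ν n (sel n B μ ν) / ∏ j ∈ Finset.range n, (1 + ε j)) ^ 2 := by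
          rw [Finset.mul_sum (Finset.range (K - J + 1))]
          refine Finset.sum_congr rfl fun n _ => ?_
          rw [Finset.mul_sum (Finset.univ : Finset (PBond (F.P J) 0)), Finset.mul_sum (Finset.univ : Finset (PBond (F.P J) 0))]
      _ ≤ _ := mul_le_mul_of_nonneg_left hE (Real.exp_nonneg _)
  -- BOTH CASES of an orientation pair, in the final currency
  have hWnn : 0 ≤ W := le_trans (by simp) (hW 0)
  have hC0 : 0 ≤ Real.exp (2 * ∑ j ∈ Finset.range (K - J), ε j) * (2 * Cst * (((5 ^ (F.P K).d : ℕ) : ℝ) ^ 2 * (((2 * (θr + 2) + 1) ^ (F.P K).d * 6 : ℕ) : ℝ) *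
              (2 * ((((F.P K).L ^ (F.P K).d : ℕ) : ℝ) - 1) / ((((F.P K).L ^ (F.P K).d : ℕ) : ℝ) - 3)))) :=
    mul_nonneg (Real.exp_nonneg _) (mul_nonneg (mul_nonneg zero_le_two hCst) hKL)
  have hT : ∀ μ ν,
      ∑ n ∈ Finset.range (K - J + 1), (if n < K - J then Cst * (F.L : ℝ) ^ (K - J - 1 - n) else 0) *
          ∑ B : PBond (F.P J) 0, (if μ < ν then ρ μ ν n (sel n B μ ν) else 0) ^ 2 ≤
        Real.exp (2 * ∑ j ∈ Finset.range (K - J), ε j) * (2 * Cst * (((5 ^ (F.P K).d : ℕ) : ℝ) ^ 2 * (((2 * (θr + 2) + 1) ^ (F.P K).d * 6 : ℕ) : ℝ) *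
              (2 * ((((F.P K).L ^ (F.P K).d : ℕ) : ℝ) - 1) / ((((F.P K).L ^ (F.P K).d : ℕ) : ℝ) - 3)))) *
            ((F.L : ℝ) ^ (K - J - 1) * (if μ < ν then ∑ z : Site (F.P K) 0, ρ μ ν 0 z ^ 2 else 0)) +
          Real.exp (2 * ∑ j ∈ Finset.range (K - J), ε j) * (2 * Cst * (((5 ^ (F.P K).d : ℕ) : ℝ) ^ 2 * (((2 * (θr + 2) + 1) ^ (F.P K).d * 6 : ℕ) : ℝ) *
              (2 * ((((F.P K).L ^ (F.P K).d : ℕ) : ℝ) - 1) / ((((F.P K).L ^ (F.P K).d : ℕ) : ℝ) - 3)))) *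
            (W * ∑ j ∈ Finset.Icc 1 (K - J), w j * (F.L : ℝ) ^ (K - J - 1 - j) * ∑ c : Site (F.P K) j, src μ ν j c ^ 2) := by
    intro μ ν
    have hS : ∀ j, 0 ≤ ∑ c : Site (F.P K) j, src μ ν j c ^ 2 := fun j => Finset.sum_nonneg fun c _ => sq_nonneg _
    have hY : 0 ≤ ∑ j ∈ Finset.Icc 1 (K - J), w j * (F.L : ℝ) ^ (K - J - 1 - j) * ∑ c : Site (F.P K) j, src μ ν j c ^ 2 :=
      Finset.sum_nonneg fun j _ => mul_nonneg (mul_nonneg (hw j).le (pow_nonneg hL0.le _)) (hS j)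
    by_cases hμν : μ < ν
    · simp only [if_pos hμν]
      have h1 := hone μ ν hμν
      simp only [Finset.prod_range_zero, div_one, mul_zero, pow_zero, one_mul] at h1
      refine h1.trans ?_
      have hsrc' : ∑ j ∈ Finset.Icc 1 (K - J), w j *
            (Cst * (F.L : ℝ) ^ (K - J - 1) / (F.L : ℝ) ^ (4 * j) * ((5 ^ (F.P K).d : ℕ) : ℝ) ^ 2 * (((2 * (θr + 2) + 1) ^ (F.P K).d * 6 : ℕ) : ℝ) * (2 * ((((F.P K).L ^ (F.P K).d : ℕ) : ℝ) - 1) / ((((F.P K).L ^ (F.P K).d : ℕ) : ℝ) - 3)) *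
              ((((F.P K).L ^ (F.P K).d : ℕ) : ℝ) ^ j * ∑ c : Site (F.P K) j, src μ ν j c ^ 2)) ≤
          Cst * (((5 ^ (F.P K).d : ℕ) : ℝ) ^ 2 * (((2 * (θr + 2) + 1) ^ (F.P K).d * 6 : ℕ) : ℝ) *
              (2 * ((((F.P K).L ^ (F.P K).d : ℕ) : ℝ) - 1) / ((((F.P K).L ^ (F.P K).d : ℕ) : ℝ) - 3))) * ∑ j ∈ Finset.Icc 1 (K - J), w j * (F.L : ℝ) ^ (K - J - 1 - j) * ∑ c : Site (F.P K) j, src μ ν j c ^ 2 := by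
        rw [Finset.mul_sum]
        refine Finset.sum_le_sum fun j _ => ?_
        have hK' : 0 ≤ Cst * (((5 ^ (F.P K).d : ℕ) : ℝ) ^ 2 * (((2 * (θr + 2) + 1) ^ (F.P K).d * 6 : ℕ) : ℝ) *
              (2 * ((((F.P K).L ^ (F.P K).d : ℕ) : ℝ) - 1) / ((((F.P K).L ^ (F.P K).d : ℕ) : ℝ) - 3))) * w j * ∑ c : Site (F.P K) j, src μ ν j c ^ 2 :=
          mul_nonneg (mul_nonneg (mul_nonneg hCst hKL) (hw j).le) (hS j)
        calc w j * (Cst * (F.L : ℝ) ^ (K - J - 1) / (F.L : ℝ) ^ (4 * j) * ((5 ^ (F.P K).d : ℕ) : ℝ) ^ 2 * (((2 * (θr + 2) + 1) ^ (F.P K).d * 6 : ℕ) : ℝ) * (2 * ((((F.P K).L ^ (F.P K).d : ℕ) : ℝ) - 1) / ((((F.P K).L ^ (F.P K).d : ℕ) : ℝ) - 3)) *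
              ((((F.P K).L ^ (F.P K).d : ℕ) : ℝ) ^ j * ∑ c : Site (F.P K) j, src μ ν j c ^ 2))
            = (Cst * (((5 ^ (F.P K).d : ℕ) : ℝ) ^ 2 * (((2 * (θr + 2) + 1) ^ (F.P K).d * 6 : ℕ) : ℝ) *
              (2 * ((((F.P K).L ^ (F.P K).d : ℕ) : ℝ) - 1) / ((((F.P K).L ^ (F.P K).d : ℕ) : ℝ) - 3))) * w j * ∑ c : Site (F.P K) j, src μ ν j c ^ 2) *
                ((F.L : ℝ) ^ (K - J - 1) / (F.L : ℝ) ^ (4 * j) * (((F.P K).L ^ (F.P K).d : ℕ) : ℝ) ^ j) := by ring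
          _ ≤ (Cst * (((5 ^ (F.P K).d : ℕ) : ℝ) ^ 2 * (((2 * (θr + 2) + 1) ^ (F.P K).d * 6 : ℕ) : ℝ) *
              (2 * ((((F.P K).L ^ (F.P K).d : ℕ) : ℝ) - 1) / ((((F.P K).L ^ (F.P K).d : ℕ) : ℝ) - 3))) * w j * ∑ c : Site (F.P K) j, src μ ν j c ^ 2) * (F.L : ℝ) ^ (K - J - 1 - j) :=
                mul_le_mul_of_nonneg_left (hpow j) hK'
          _ = Cst * (((5 ^ (F.P K).d : ℕ) : ℝ) ^ 2 * (((2 * (θr + 2) + 1) ^ (F.P K).d * 6 : ℕ) : ℝ) *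
              (2 * ((((F.P K).L ^ (F.P K).d : ℕ) : ℝ) - 1) / ((((F.P K).L ^ (F.P K).d : ℕ) : ℝ) - 3))) * (w j * (F.L : ℝ) ^ (K - J - 1 - j) * ∑ c : Site (F.P K) j, src μ ν j c ^ 2) := by ring
      have h2W : 0 ≤ 2 * W := mul_nonneg zero_le_two hWnn
      calc Real.exp (2 * ∑ j ∈ Finset.range (K - J), ε j) *
            (2 * (Cst * (F.L : ℝ) ^ (K - J - 1) * ((5 ^ (F.P K).d : ℕ) : ℝ) ^ 2 * (((2 * (θr + 2) + 1) ^ (F.P K).d * 6 : ℕ) : ℝ) * (2 * ((((F.P K).L ^ (F.P K).d : ℕ) : ℝ) - 1) / ((((F.P K).L ^ (F.P K).d : ℕ) : ℝ) - 3)) * ∑ z : Site (F.P K) 0, ρ μ ν 0 z ^ 2) +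
              2 * W * ∑ j ∈ Finset.Icc 1 (K - J), w j *
                (Cst * (F.L : ℝ) ^ (K - J - 1) / (F.L : ℝ) ^ (4 * j) * ((5 ^ (F.P K).d : ℕ) : ℝ) ^ 2 * (((2 * (θr + 2) + 1) ^ (F.P K).d * 6 : ℕ) : ℝ) * (2 * ((((F.P K).L ^ (F.P K).d : ℕ) : ℝ) - 1) / ((((F.P K).L ^ (F.P K).d : ℕ) : ℝ) - 3)) *
                  ((((F.P K).L ^ (F.P K).d : ℕ) : ℝ) ^ j * ∑ c : Site (F.P K) j, src μ ν j c ^ 2)))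
          ≤ Real.exp (2 * ∑ j ∈ Finset.range (K - J), ε j) *
            (2 * (Cst * (F.L : ℝ) ^ (K - J - 1) * ((5 ^ (F.P K).d : ℕ) : ℝ) ^ 2 * (((2 * (θr + 2) + 1) ^ (F.P K).d * 6 : ℕ) : ℝ) * (2 * ((((F.P K).L ^ (F.P K).d : ℕ) : ℝ) - 1) / ((((F.P K).L ^ (F.P K).d : ℕ) : ℝ) - 3)) * ∑ z : Site (F.P K) 0, ρ μ ν 0 z ^ 2) +
              2 * W * (Cst * (((5 ^ (F.P K).d : ℕ) : ℝ) ^ 2 * (((2 * (θr + 2) + 1) ^ (F.P K).d * 6 : ℕ) : ℝ) *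
              (2 * ((((F.P K).L ^ (F.P K).d : ℕ) : ℝ) - 1) / ((((F.P K).L ^ (F.P K).d : ℕ) : ℝ) - 3))) * ∑ j ∈ Finset.Icc 1 (K - J), w j * (F.L : ℝ) ^ (K - J - 1 - j) * ∑ c : Site (F.P K) j, src μ ν j c ^ 2)) :=
            mul_le_mul_of_nonneg_left (add_le_add le_rfl (mul_le_mul_of_nonneg_left hsrc' h2W)) (Real.exp_nonneg _)
        _ = _ := by ring
    · simp only [if_neg hμν]
      have hz : ∑ n ∈ Finset.range (K - J + 1), (if n < K - J then Cst * (F.L : ℝ) ^ (K - J - 1 - n) else 0) *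
          ∑ B : PBond (F.P J) 0, (0 : ℝ) ^ 2 = 0 := by simp
      rw [hz, mul_zero, mul_zero, zero_add]
      exact mul_nonneg hC0 (mul_nonneg hWnn hY)
  -- the source sums, orientations inside
  have hswap : ∑ μ : Fin (F.P K).d, ∑ ν : Fin (F.P K).d, ∑ j ∈ Finset.Icc 1 (K - J), w j * (F.L : ℝ) ^ (K - J - 1 - j) * ∑ c : Site (F.P K) j, src μ ν j c ^ 2 =
      ∑ j ∈ Finset.Icc 1 (K - J), w j * (F.L : ℝ) ^ (K - J - 1 - j) * ∑ μ : Fin (F.P K).d, ∑ ν : Fin (F.P K).d, ∑ c : Site (F.P K) j, src μ ν j c ^ 2 := by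
    simp_rw [Finset.mul_sum]
    exact (Finset.sum_congr rfl fun μ _ => Finset.sum_comm).trans Finset.sum_comm
  calc ∑ μ, ∑ ν, ∑ n ∈ Finset.range (K - J + 1), (if n < K - J then Cst * (F.L : ℝ) ^ (K - J - 1 - n) else 0) *
          ∑ B : PBond (F.P J) 0, (if μ < ν then ρ μ ν n (sel n B μ ν) else 0) ^ 2
      ≤ ∑ μ : Fin (F.P K).d, ∑ ν : Fin (F.P K).d,
          (Real.exp (2 * ∑ j ∈ Finset.range (K - J), ε j) * (2 * Cst * (((5 ^ (F.P K).d : ℕ) : ℝ) ^ 2 * (((2 * (θr + 2) + 1) ^ (F.P K).d * 6 : ℕ) : ℝ) *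
              (2 * ((((F.P K).L ^ (F.P K).d : ℕ) : ℝ) - 1) / ((((F.P K).L ^ (F.P K).d : ℕ) : ℝ) - 3)))) *
              ((F.L : ℝ) ^ (K - J - 1) * (if μ < ν then ∑ z : Site (F.P K) 0, ρ μ ν 0 z ^ 2 else 0)) +
            Real.exp (2 * ∑ j ∈ Finset.range (K - J), ε j) * (2 * Cst * (((5 ^ (F.P K).d : ℕ) : ℝ) ^ 2 * (((2 * (θr + 2) + 1) ^ (F.P K).d * 6 : ℕ) : ℝ) *
              (2 * ((((F.P K).L ^ (F.P K).d : ℕ) : ℝ) - 1) / ((((F.P K).L ^ (F.P K).d : ℕ) : ℝ) - 3)))) *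
              (W * ∑ j ∈ Finset.Icc 1 (K - J), w j * (F.L : ℝ) ^ (K - J - 1 - j) * ∑ c : Site (F.P K) j, src μ ν j c ^ 2)) :=
        Finset.sum_le_sum fun μ _ => Finset.sum_le_sum fun ν _ => hT μ ν
    _ = _ := by
        simp only [Finset.sum_add_distrib, ← Finset.mul_sum]
        rw [hswap, ← mul_add]

end Summit.QuantumFields.YangMills.Theorems.FluctuationComparisonRegPrIntLS2BetaCurlBudgetEngine

end
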